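import Summits.QuantumFields.BalabanUV.Beta.FP.CovarianceGaugeFactor
import Literature.MathematicalPhysics.QuantumFieldTheory.Balaban1983to89.B5Adjoint130

/-!
# `BalabanUV.Beta.FP.ScalarPropagatorProjection` — road «FP» (binder row D1), lane IR-5′, **THE (T0′) SUPPLIER CHAIN, FILE 4a: THE TREE'S GAUGE
# PROJECTOR `R = RT` IS B5's MASSIVE FORM (1.44)** — `R = 1 − G′·Q′*·(Q′G′²Q′*)⁻¹·Q′·G′` with `G′ = (Δ + bQ′*Q′)⁻¹` (every `b > 0`) on b05's typed
# torus, together with `Δ + bQ′*Q′` invertible, `Q′·Q′* = 1`, and `R·Δ⁻¹ = R·G′` (our bookkeeping ∕ B5 Sect. C algebra over the tree's operators BY NAME)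

HONEST DEPENDENCY (page 1, mandatory): continuum YM on T⁴ ⇐ BetaPertH ∧ nine spine estimates (0/9 proved); BetaPertH ⇐ (D1) ∧ (D4) ∧
CAP+tail; G-an2-4 gates asym, D1 and NE2/3/4.  HONEST FRAMING (cell contract, verbatim): «discharging `BetaPertH` makes Bałaban's UV
stability UNCONDITIONAL — a real constructive-QFT result; it is NOT the continuum limit and NOT the Clay problem.»  THIS MODULE is finite-dimensional
linear algebra over the tree's typed torus operators of B5 Sects. C–E (`B5Action121.LapS`∕`GradOp` = Δ, ∂; `B5Block118.QsOp` = Q′ (1.20);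
`B5Hk160Torus.QsAdj` = Q′* = n^d·Q′ᴴ (1.21); `B5LaplaceInverse.LapSinv`∕`Pker` = the pseudo-inverse Δ⁻¹ and the projection on constants (p. 22);
`B5Identities197Torus.RT` = the p. 25 projection onto `ΔN(Q′)`, typed as `1 − PcT − Pker` with the MASSLESS `PcT` of (1.26)∕(1.38)).  It cites nothing
as a hypothesis, mints no `Prop`, has no `def`, 0 sorry; it proves NO estimate.  NOT (T0′), NOT hslice, NOT (ASYMP), NOT D1, NOT BetaPertH, NOT continuum,
NOT Clay.

ABSOLUTE RULE (cell charter, verbatim): «No internally-minted statement may enter as a cited fact. Every hypothesis is either kernel-proved in this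
package or a verbatim quotation of a PUBLISHED theorem with page reference. The manuscript(s) under audit are NOT citable for their own disputed
steps — they are the thing under adjudication; programme-internal (2001/route/tribunal) claims are never citable.»

WHY (the (T0′) supplier chain, `FF-LEG-LETTERS.md` v2 §4; files 1–3 = `CovarianceGaugeFactor`, `CovarianceRowSum`, `CovarianceConstraintRowSum`).
After file 3 the row-sum letter of the hard covariance `𝒞` rests on the two letters `cA`, `cB` = rows of `∂·Δ⁻¹·R` and `R·Δ⁻¹·∂ᴴ`.  As written these are
NOT products of volume-uniform letters: the pseudo-inverse `Δ⁻¹` and the massless factors `Δ⁻¹Q′ᴴ`, `(Q′Δ⁻²Q′ᴴ)⁻¹` of `PcT` are infrared-divergent on a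
large torus.  Uniformity lives in the MASSIVE form only: B5 p. 25 (1.42)–(1.44) «Δ′_a = Δ + aQ′_k*Q′_k … its inverse is a bounded operator G′_k … and for
the projection operator R: R = I − G′_kQ′_k*(Q′_kG′_k²Q′_k*)⁻¹Q′_kG′_k. (1.44) Now all the operators appearing in these formulas are well defined. We have
to verify it only for (Q′_kG′_k²Q′_k*)⁻¹. It is enough to prove that Q′_kG′_k²Q′_k* is positive definite.»; p. 26 «The operator R given by (1.44) is of
course by definition independent of a and we can take arbitrary a in the representation, e.g. a = 1, which is most convenient for bounds.»  This file
PROVES (1.44) for the tree's `RT` on the finite torus (the tree's abstract twin `B5Projector144.R138_eq_R144_add_proj1` lives on real inner-product spaces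
with hypothesis bundles and is not instantiated here; nothing of it is used or restated as a hypothesis).  File 4b (`CovarianceScalarLetters`) turns
(1.44) into row-sum bookkeeping: `cA`, `cB` ⇐ four `ℓ^∞ → ℓ^∞` letters of the massive SCALAR `G′` and of `(Q′G′²Q′*)⁻¹`.

CONTENT (general `d`, `M : Fin d → ℕ`, `n ≥ 1`; inverses supplied AS DATA `G`, `C` with the identities a statement needs displayed as hypotheses, and
discharged for the concrete `(Δ + bQ′*Q′)⁻¹`, `(Q′G′²Q′*)⁻¹` in §5).  §1 `form_QsAdj_QsOp`, `form_DeltaP` (`⟨v,(Δ + bQ′*Q′)v⟩ = ‖∂v‖² + b·n^d‖Q′v‖²`),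
**`DeltaP_mulVec_eq_zero`**∕**`isUnit_DeltaP`** (`b > 0`), `QsAdj_QsOp_conjTranspose`, `DeltaP_conjTranspose`; §2 `QsAdj_mulVec_eq`, **`QsOp_mul_QsAdj`**
(`Q′·Q′* = 1`), `QsAdj_mulVec_injective`, `QsOp_eq_smul_conjTranspose_QsAdj`; §3 **`RT_mul_LapSinv_eq`** (`R·Δ⁻¹ = R·G` for ANY right inverse `G` of
`Δ + bQ′*Q′`, from file 1's `RT_LapSinv_mul_opGp`), `RT_LapSinv_divS_eq`, `grad_LapSinv_RT_eq`; §4 generic `eq_of_idem_herm_fix` (two Hermitian idempotents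
with the same fixed vectors coincide), `QGGQ_eq_smul_gram`, **`QGGQ_mulVec_eq_zero`**, `proj144_mul_proj144`, `proj144_conjTranspose`,
**`proj144_mulVec_eq_zero_iff`** (`P₁.₄₄w = 0 ↔ ∃ l, Q′l = 0 ∧ w = Δl` — p. 25 «R = ΔN(Q′_k)»), **`RT_eq_one_sub_proj144`**; §5 the concrete instance:
`isUnit_QGGQ_inv`, `QGGQ_inv_conjTranspose`, **`RT_eq_one_sub_proj144_inv`** — `RT n M = 1 − G′·Q′*·(Q′·G′·G′·Q′*)⁻¹·Q′·G′`, `G′ = (Δ + bQ′*Q′)⁻¹`, every `b > 0`.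
Unit `b2b-balaban-beta-d1-formalise-leaf-05` (gen 19; D1 formalisation swarm leaf seat, road FP lane IR-5′), 2026-08-21; `LEAVES-FP.md` row «(T0′) CHAIN FILE 4a».
«printed: B5 (1.42)–(1.44) p. 25, p. 26 ll. 5–7; the typed identity on the finite torus and its proof are ours».
-/

noncomputable section

open scoped BigOperators Matrix ComplexConjugate ComplexOrder

namespace Summit.QuantumFields.BalabanUV.Beta.FP.ScalarPropagatorProjection

open Literature.MathematicalPhysics.QuantumFieldTheory.Balaban1983to89
open Literature.MathematicalPhysics.QuantumFieldTheory.Balaban1983to89.B5Prop11Plancherel (Tor fine)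
open Literature.MathematicalPhysics.QuantumFieldTheory.Balaban1983to89.B5Action121 (GradOp LapS GradOp_conjTranspose_mul_GradOp form_gram_rect
  form_grad_eq_form_LapS)
open Literature.MathematicalPhysics.QuantumFieldTheory.Balaban1983to89.B5Block118 (QsOp)
open Literature.MathematicalPhysics.QuantumFieldTheory.Balaban1983to89.B5Blocks16 (blockOf QsOp_blockConst)
open Literature.MathematicalPhysics.QuantumFieldTheory.Balaban1983to89.B5Adjoint130 (QsOp_adjoint_mulVec)
open Literature.MathematicalPhysics.QuantumFieldTheory.Balaban1983to89.B5LaplaceSpectral (LapS_const LapS_ker_const)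
open Literature.MathematicalPhysics.QuantumFieldTheory.Balaban1983to89.B5LaplaceInverse (LapSinv LapSinv_conjTranspose)
open Literature.MathematicalPhysics.QuantumFieldTheory.Balaban1983to89.B5Hk160Torus (QsAdj)
open Literature.MathematicalPhysics.QuantumFieldTheory.Balaban1983to89.B5Identities197Torus (RT RT_conjTranspose RT_mul_RT RT_mulVec_eq_self_iff)
open Literature.MathematicalPhysics.QuantumFieldTheory.Balaban1983to89.Beta.VectorPropagatorDict (ext_of_mulVec')
open Summit.QuantumFields.BalabanUV.Beta.FP.CovarianceGaugeFactor (RT_LapSinv_mul_opGp)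

/-! ## §4₀ Two Hermitian idempotents with the same fixed vectors coincide (generic) -/

section Generic

variable {ι : Type*} [Fintype ι] [DecidableEq ι]

/-- [folklore] **an orthogonal projection is determined by its fixed space**: if `E`, `F` are Hermitian idempotent complex matrices and
`E v = v ↔ F v = v` for every `v`, then `E = F` (`F·E = E`, `E·F = F`, adjoint of the first). -/
theorem eq_of_idem_herm_fix {E F : Matrix ι ι ℂ} (hE : E * E = E) (hF : F * F = F) (hEh : Eᴴ = E) (hFh : Fᴴ = F)
    (hfix : ∀ v : ι → ℂ, E *ᵥ v = v ↔ F *ᵥ v = v) : E = F := by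
  have hFE : F * E = E := ext_of_mulVec' fun v => by
    rw [← Matrix.mulVec_mulVec]
    exact (hfix _).mp (by rw [Matrix.mulVec_mulVec, hE])
  have hEF : E * F = F := ext_of_mulVec' fun v => by
    rw [← Matrix.mulVec_mulVec]
    exact (hfix _).mpr (by rw [Matrix.mulVec_mulVec, hF])
  have h := congrArg Matrix.conjTranspose hFE
  rw [Matrix.conjTranspose_mul, hEh, hFh, hEF] at h
  exact h.symm

end Generic

variable {d : ℕ} (n : ℕ) [NeZero n] (M : Fin d → ℕ) [hM : ∀ μ, NeZero (M μ)]

/-! ## §1 The massive scalar operator `Δ′_b = Δ + bQ′*Q′` ((1.42)) is invertible on the torus for `b > 0` -/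

/-- [folklore] `⟨v, Q′*Q′v⟩ = n^d·‖Q′v‖²` (`Q′* = n^d·Q′ᴴ`, (1.21)). -/
theorem form_QsAdj_QsOp (v : Tor (fine n M) → ℂ) :
    star v ⬝ᵥ ((QsAdj n M * QsOp n M) *ᵥ v) = (n : ℂ) ^ d * (star (QsOp n M *ᵥ v) ⬝ᵥ (QsOp n M *ᵥ v)) := by
  rw [QsAdj, Matrix.smul_mul, Matrix.smul_mulVec, dotProduct_smul, smul_eq_mul, form_gram_rect]

/-- [folklore] **the form of `Δ′_b`**: `⟨v, (Δ + bQ′*Q′)v⟩ = ‖∂v‖² + b·n^d·‖Q′v‖²`. -/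
theorem form_DeltaP (b : ℝ) (v : Tor (fine n M) → ℂ) :
    star v ⬝ᵥ ((LapS (fine n M) (n : ℂ) + (b : ℂ) • (QsAdj n M * QsOp n M)) *ᵥ v)
      = star (GradOp (fine n M) (n : ℂ) *ᵥ v) ⬝ᵥ (GradOp (fine n M) (n : ℂ) *ᵥ v)
        + (b : ℂ) * (n : ℂ) ^ d * (star (QsOp n M *ᵥ v) ⬝ᵥ (QsOp n M *ᵥ v)) := by
  rw [Matrix.add_mulVec, dotProduct_add, Matrix.smul_mulVec, dotProduct_smul, smul_eq_mul, form_QsAdj_QsOp,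
    form_grad_eq_form_LapS, mul_assoc]

/-- [folklore] **`Δ + bQ′*Q′` is injective for `b > 0`** («its inverse is a bounded operator G′_k», p. 25): `(Δ + bQ′*Q′)v = 0` forces `∂v = 0`
(so `v` is constant, `B5LaplaceSpectral.LapS_ker_const`) and `Q′v = 0` (so the constant vanishes, `B5Blocks16.QsOp_blockConst`). -/
theorem DeltaP_mulVec_eq_zero {b : ℝ} (hb : 0 < b) {v : Tor (fine n M) → ℂ}
    (hv : (LapS (fine n M) (n : ℂ) + (b : ℂ) • (QsAdj n M * QsOp n M)) *ᵥ v = 0) : v = 0 := by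
  have hc : (n : ℂ) ≠ 0 := Nat.cast_ne_zero.mpr (NeZero.ne n)
  have hform := form_DeltaP n M b v
  rw [hv, dotProduct_zero] at hform
  have h1 : 0 ≤ star (GradOp (fine n M) (n : ℂ) *ᵥ v) ⬝ᵥ (GradOp (fine n M) (n : ℂ) *ᵥ v) := dotProduct_star_self_nonneg _
  have h2 : 0 ≤ star (QsOp n M *ᵥ v) ⬝ᵥ (QsOp n M *ᵥ v) := dotProduct_star_self_nonneg _
  have hbn : (0 : ℂ) < (b : ℂ) * (n : ℂ) ^ d := by
    have hr : (0 : ℝ) < b * (n : ℝ) ^ d := mul_pos hb (pow_pos (Nat.cast_pos.mpr (Nat.pos_of_ne_zero (NeZero.ne n))) d)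
    have : (b : ℂ) * (n : ℂ) ^ d = ((b * (n : ℝ) ^ d : ℝ) : ℂ) := by push_cast; ring
    rw [this]
    exact_mod_cast hr
  obtain ⟨hD, hQ⟩ := (add_eq_zero_iff_of_nonneg h1 (mul_nonneg hbn.le h2)).mp hform.symm
  have hQ' : QsOp n M *ᵥ v = 0 :=
    dotProduct_star_self_eq_zero.mp ((mul_eq_zero.mp hQ).resolve_left hbn.ne')
  have hD' : GradOp (fine n M) (n : ℂ) *ᵥ v = 0 := dotProduct_star_self_eq_zero.mp hD
  -- `Δv = ∂ᴴ∂v = 0`, so `v` is the constant `v 0`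
  have hL : LapS (fine n M) (n : ℂ) *ᵥ v = 0 := by
    rw [← GradOp_conjTranspose_mul_GradOp, ← Matrix.mulVec_mulVec, hD', Matrix.mulVec_zero]
  -- `Q′(const c) = const c`, so `c = 0`
  have h3 : QsOp n M *ᵥ v = fun _ => v 0 := by
    convert QsOp_blockConst n M (fun _ : Tor M => v 0) using 2
    funext x
    exact LapS_ker_const (fine n M) hc v hL x
  have h0 : v 0 = 0 := by
    have := congrFun (h3.symm.trans hQ') (0 : Tor M)
    simpa using this
  funext x
  rw [Pi.zero_apply, LapS_ker_const (fine n M) hc v hL x, h0]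

/-- [folklore] **`Δ + bQ′*Q′` is invertible for `b > 0`** (`Matrix.mulVec_injective_iff_isUnit`). -/
theorem isUnit_DeltaP {b : ℝ} (hb : 0 < b) : IsUnit (LapS (fine n M) (n : ℂ) + (b : ℂ) • (QsAdj n M * QsOp n M)) := by
  refine Matrix.mulVec_injective_iff_isUnit.mp fun v w h => ?_
  rw [← sub_eq_zero]
  refine DeltaP_mulVec_eq_zero n M hb ?_
  rw [Matrix.mulVec_sub, h, sub_self]

omit [NeZero n] in
/-- [folklore] `(Q′*Q′)ᴴ = Q′*Q′` (`n^d` is real). -/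
theorem QsAdj_QsOp_conjTranspose : (QsAdj n M * QsOp n M)ᴴ = QsAdj n M * QsOp n M := by
  have hs : star ((n : ℂ) ^ d) = (n : ℂ) ^ d := by rw [star_pow, Complex.star_def, Complex.conj_natCast]
  rw [QsAdj, Matrix.smul_mul, Matrix.conjTranspose_smul, Matrix.conjTranspose_mul, Matrix.conjTranspose_conjTranspose, hs]

/-- [folklore] `(Δ + bQ′*Q′)ᴴ = Δ + bQ′*Q′` (`Δ = ∂ᴴ∂`, `b` real). -/
theorem DeltaP_conjTranspose (b : ℝ) :
    (LapS (fine n M) (n : ℂ) + (b : ℂ) • (QsAdj n M * QsOp n M))ᴴ = LapS (fine n M) (n : ℂ) + (b : ℂ) • (QsAdj n M * QsOp n M) := by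
  rw [Matrix.conjTranspose_add, Matrix.conjTranspose_smul, QsAdj_QsOp_conjTranspose, ← GradOp_conjTranspose_mul_GradOp,
    Matrix.conjTranspose_mul, Matrix.conjTranspose_conjTranspose, Complex.star_def, Complex.conj_ofReal]

/-! ## §2 `Q′·Q′* = 1`: the weighted adjoint is a right inverse of the block average -/

/-- [folklore] `(Q′*ω)(x) = ω(block of x)` (`B5Adjoint130.QsOp_adjoint_mulVec` × `n^d`). -/
theorem QsAdj_mulVec_eq (ω : Tor M → ℂ) : QsAdj n M *ᵥ ω = fun x => ω (blockOf n M x) := by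
  have hc : (n : ℂ) ^ d ≠ 0 := pow_ne_zero _ (Nat.cast_ne_zero.mpr (NeZero.ne n))
  funext x
  rw [QsAdj, Matrix.smul_mulVec, Pi.smul_apply, QsOp_adjoint_mulVec, smul_eq_mul]
  field_simp

/-- [folklore] **`Q′·Q′* = 1`** on the unit torus: the block average of the block-constant extension is the identity (`QsOp_blockConst`). -/
theorem QsOp_mul_QsAdj : QsOp n M * QsAdj n M = 1 :=
  ext_of_mulVec' fun ω => by rw [← Matrix.mulVec_mulVec, Matrix.one_mulVec, QsAdj_mulVec_eq, QsOp_blockConst]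

/-- [folklore] hence `Q′*` is injective. -/
theorem QsAdj_mulVec_injective : Function.Injective (QsAdj n M).mulVec := by
  intro ω ω' h
  have h' := congrArg (QsOp n M).mulVec h
  simp only [Matrix.mulVec_mulVec, QsOp_mul_QsAdj, Matrix.one_mulVec] at h'
  exact h'

omit hM in
/-- [folklore] `Q′ = n^{−d}·(Q′*)ᴴ`. -/
theorem QsOp_eq_smul_conjTranspose_QsAdj : QsOp n M = ((n : ℂ) ^ d)⁻¹ • (QsAdj n M)ᴴ := by
  have hc : (n : ℂ) ^ d ≠ 0 := pow_ne_zero _ (Nat.cast_ne_zero.mpr (NeZero.ne n))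
  have hs : star ((n : ℂ) ^ d) = (n : ℂ) ^ d := by rw [star_pow, Complex.star_def, Complex.conj_natCast]
  rw [QsAdj, Matrix.conjTranspose_smul, Matrix.conjTranspose_conjTranspose, hs, smul_smul, inv_mul_cancel₀ hc, one_smul]

/-! ## §3 `R·Δ⁻¹ = R·G′` for any right inverse `G′` of `Δ + bQ′*Q′` -/

/-- [our bookkeeping] **`R·Δ⁻¹ = R·G′`**: for any `G` with `(Δ + bQ′*Q′)·G = 1`, `RT·LapSinv = RT·G` — file 1's `RT_LapSinv_mul_opGp`
(`R·Δ⁻¹·(Δ + bQ′*Q′) = R`) multiplied by `G` on the right. -/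
theorem RT_mul_LapSinv_eq (b : ℝ) {G : Matrix (Tor (fine n M)) (Tor (fine n M)) ℂ}
    (hG : (LapS (fine n M) (n : ℂ) + (b : ℂ) • (QsAdj n M * QsOp n M)) * G = 1) :
    RT n M * LapSinv (fine n M) (n : ℂ) = RT n M * G := by
  calc RT n M * LapSinv (fine n M) (n : ℂ)
      = RT n M * LapSinv (fine n M) (n : ℂ) * ((LapS (fine n M) (n : ℂ) + (b : ℂ) • (QsAdj n M * QsOp n M)) * G) := by
        rw [hG, Matrix.mul_one]
    _ = (RT n M * LapSinv (fine n M) (n : ℂ) * (LapS (fine n M) (n : ℂ) + (b : ℂ) • (QsAdj n M * QsOp n M))) * G := by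
        simp only [Matrix.mul_assoc]
    _ = RT n M * G := by rw [RT_LapSinv_mul_opGp]

/-- [our bookkeeping] the `cB`-kernel in massive form: `R·Δ⁻¹·∂ᴴ = R·G·∂ᴴ`. -/
theorem RT_LapSinv_divS_eq (b : ℝ) {G : Matrix (Tor (fine n M)) (Tor (fine n M)) ℂ}
    (hG : (LapS (fine n M) (n : ℂ) + (b : ℂ) • (QsAdj n M * QsOp n M)) * G = 1) :
    RT n M * LapSinv (fine n M) (n : ℂ) * (GradOp (fine n M) (n : ℂ))ᴴ = RT n M * G * (GradOp (fine n M) (n : ℂ))ᴴ := by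
  rw [RT_mul_LapSinv_eq n M b hG]

/-- [our bookkeeping] the `cA`-kernel in massive form: `∂·Δ⁻¹·R = ∂·G·R` for a Hermitian right inverse `G` (adjoint of §3's identity). -/
theorem grad_LapSinv_RT_eq (b : ℝ) {G : Matrix (Tor (fine n M)) (Tor (fine n M)) ℂ}
    (hG : (LapS (fine n M) (n : ℂ) + (b : ℂ) • (QsAdj n M * QsOp n M)) * G = 1) (hGh : Gᴴ = G) :
    GradOp (fine n M) (n : ℂ) * LapSinv (fine n M) (n : ℂ) * RT n M = GradOp (fine n M) (n : ℂ) * G * RT n M := by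
  have h := congrArg Matrix.conjTranspose (RT_mul_LapSinv_eq n M b hG)
  rw [Matrix.conjTranspose_mul, Matrix.conjTranspose_mul, RT_conjTranspose, LapSinv_conjTranspose, hGh] at h
  rw [Matrix.mul_assoc, h, ← Matrix.mul_assoc]

/-! ## §4 (1.44): `R = 1 − G′Q′*(Q′G′²Q′*)⁻¹Q′G′`, with the inverses as data -/

section P144

variable (b : ℝ) {G : Matrix (Tor (fine n M)) (Tor (fine n M)) ℂ} {C : Matrix (Tor M) (Tor M) ℂ}

/-- [folklore] **`Q′G²Q′* = n^{−d}·(GQ′*)ᴴ(GQ′*)`** for Hermitian `G` (`Q′ = n^{−d}(Q′*)ᴴ`). -/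
theorem QGGQ_eq_smul_gram (hGh : Gᴴ = G) :
    QsOp n M * G * G * QsAdj n M = ((n : ℂ) ^ d)⁻¹ • ((G * QsAdj n M)ᴴ * (G * QsAdj n M)) := by
  rw [QsOp_eq_smul_conjTranspose_QsAdj, Matrix.conjTranspose_mul, hGh]
  simp only [Matrix.smul_mul, Matrix.mul_assoc]

/-- [folklore] **«It is enough to prove that Q′_kG′_k²Q′_k* is positive definite»** (p. 25), injectivity form: `⟨ω, Q′G²Q′*ω⟩ = n^{−d}‖GQ′*ω‖²`,
and `G`, `Q′*` are injective (`G` a left-invertible matrix: `(Δ + bQ′*Q′)·G = 1`). -/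
theorem QGGQ_mulVec_eq_zero (hG : (LapS (fine n M) (n : ℂ) + (b : ℂ) • (QsAdj n M * QsOp n M)) * G = 1) (hGh : Gᴴ = G)
    {ω : Tor M → ℂ} (hω : (QsOp n M * G * G * QsAdj n M) *ᵥ ω = 0) : ω = 0 := by
  have hc : ((n : ℂ) ^ d)⁻¹ ≠ 0 := inv_ne_zero (pow_ne_zero _ (Nat.cast_ne_zero.mpr (NeZero.ne n)))
  have hform : star ω ⬝ᵥ ((QsOp n M * G * G * QsAdj n M) *ᵥ ω)
      = ((n : ℂ) ^ d)⁻¹ * (star ((G * QsAdj n M) *ᵥ ω) ⬝ᵥ ((G * QsAdj n M) *ᵥ ω)) := by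
    rw [QGGQ_eq_smul_gram n M hGh, Matrix.smul_mulVec, dotProduct_smul, smul_eq_mul, form_gram_rect]
  rw [hω, dotProduct_zero] at hform
  have h0 : (G * QsAdj n M) *ᵥ ω = 0 :=
    dotProduct_star_self_eq_zero.mp ((mul_eq_zero.mp hform.symm).resolve_left hc)
  have h1 : QsAdj n M *ᵥ ω = 0 := by
    have h' := congrArg (LapS (fine n M) (n : ℂ) + (b : ℂ) • (QsAdj n M * QsOp n M)).mulVec h0
    simp only [Matrix.mulVec_mulVec, ← Matrix.mul_assoc, hG, Matrix.one_mul, Matrix.mulVec_zero] at h'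
    exact h'
  exact QsAdj_mulVec_injective n M (by rw [h1, Matrix.mulVec_zero])

/-- [folklore] **idempotence**: `P·P = P` for `P = GQ′*CQ′G` with `C·(Q′G²Q′*) = 1`. -/
theorem proj144_mul_proj144 (hC : C * (QsOp n M * G * G * QsAdj n M) = 1) :
    (G * QsAdj n M * C * QsOp n M * G) * (G * QsAdj n M * C * QsOp n M * G) = G * QsAdj n M * C * QsOp n M * G := by
  calc (G * QsAdj n M * C * QsOp n M * G) * (G * QsAdj n M * C * QsOp n M * G)
      = G * QsAdj n M * (C * (QsOp n M * G * G * QsAdj n M)) * C * QsOp n M * G := by simp only [Matrix.mul_assoc]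
    _ = G * QsAdj n M * C * QsOp n M * G := by rw [hC, Matrix.mul_one]

/-- [folklore] **self-adjointness**: `Pᴴ = P` for Hermitian `G`, `C` (the weights of `Q′*` and `Q′` cancel). -/
theorem proj144_conjTranspose (hGh : Gᴴ = G) (hCh : Cᴴ = C) :
    (G * QsAdj n M * C * QsOp n M * G)ᴴ = G * QsAdj n M * C * QsOp n M * G := by
  have hc : (n : ℂ) ^ d ≠ 0 := pow_ne_zero _ (Nat.cast_ne_zero.mpr (NeZero.ne n))
  have hs : star ((n : ℂ) ^ d) = (n : ℂ) ^ d := by rw [star_pow, Complex.star_def, Complex.conj_natCast]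
  have hQ : (QsOp n M)ᴴ = ((n : ℂ) ^ d)⁻¹ • QsAdj n M := by
    rw [QsAdj, smul_smul, inv_mul_cancel₀ hc, one_smul]
  have hQs : (QsAdj n M)ᴴ = (n : ℂ) ^ d • QsOp n M := by
    rw [QsAdj, Matrix.conjTranspose_smul, Matrix.conjTranspose_conjTranspose, hs]
  simp only [Matrix.conjTranspose_mul, hGh, hCh, hQ, hQs, Matrix.smul_mul, Matrix.mul_smul, smul_smul, mul_inv_cancel₀ hc, one_smul,
    Matrix.mul_assoc]

/-- [folklore] **the kernel of `P₁.₄₄` is `ΔN(Q′)`** (p. 25 «R = ΔN(Q′_k)», for the massive representation): with `(Δ + bQ′*Q′)·G = 1 = G·(Δ + bQ′*Q′)`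
and `C·(Q′G²Q′*) = 1`, `P w = 0 ↔ ∃ l, Q′l = 0 ∧ w = Δl` (`l = Gw`; on `N(Q′)` the mass term `bQ′*Q′` vanishes). -/
theorem proj144_mulVec_eq_zero_iff (hG : (LapS (fine n M) (n : ℂ) + (b : ℂ) • (QsAdj n M * QsOp n M)) * G = 1)
    (hG' : G * (LapS (fine n M) (n : ℂ) + (b : ℂ) • (QsAdj n M * QsOp n M)) = 1)
    (hC : C * (QsOp n M * G * G * QsAdj n M) = 1) (w : Tor (fine n M) → ℂ) :
    (G * QsAdj n M * C * QsOp n M * G) *ᵥ w = 0 ↔ ∃ l : Tor (fine n M) → ℂ, QsOp n M *ᵥ l = 0 ∧ w = LapS (fine n M) (n : ℂ) *ᵥ l := by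
  constructor
  · intro h
    -- peel `G`, `Q′*`, `C` off the left: `Q′Gw = 0`
    have h1 : QsAdj n M *ᵥ (C *ᵥ (QsOp n M *ᵥ (G *ᵥ w))) = 0 := by
      have h' := congrArg (LapS (fine n M) (n : ℂ) + (b : ℂ) • (QsAdj n M * QsOp n M)).mulVec h
      simp only [Matrix.mulVec_mulVec, ← Matrix.mul_assoc, hG, Matrix.one_mul, Matrix.mulVec_zero] at h'
      simpa only [Matrix.mulVec_mulVec, Matrix.mul_assoc] using h'
    have h2 : C *ᵥ (QsOp n M *ᵥ (G *ᵥ w)) = 0 := QsAdj_mulVec_injective n M (by rw [h1, Matrix.mulVec_zero])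
    have h3 : QsOp n M *ᵥ (G *ᵥ w) = 0 := by
      have h' := congrArg (QsOp n M * G * G * QsAdj n M).mulVec h2
      rw [Matrix.mulVec_mulVec] at h'
      -- `(Q′G²Q′*)·C = 1` from `C·(Q′G²Q′*) = 1` (square matrices)
      have hC' : QsOp n M * G * G * QsAdj n M * C = 1 := mul_eq_one_comm.mp hC
      rw [hC', Matrix.one_mulVec, Matrix.mulVec_zero] at h'
      exact h'
    refine ⟨G *ᵥ w, h3, ?_⟩
    have h4 : (LapS (fine n M) (n : ℂ) + (b : ℂ) • (QsAdj n M * QsOp n M)) *ᵥ (G *ᵥ w) = w := by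
      rw [Matrix.mulVec_mulVec, hG, Matrix.one_mulVec]
    rw [Matrix.add_mulVec, Matrix.smul_mulVec, ← Matrix.mulVec_mulVec, h3, Matrix.mulVec_zero, smul_zero, add_zero] at h4
    exact h4.symm
  · rintro ⟨l, hl, rfl⟩
    have h4 : G *ᵥ (LapS (fine n M) (n : ℂ) *ᵥ l) = l := by
      have h' : (G * (LapS (fine n M) (n : ℂ) + (b : ℂ) • (QsAdj n M * QsOp n M))) *ᵥ l = l := by rw [hG', Matrix.one_mulVec]
      rw [← Matrix.mulVec_mulVec, Matrix.add_mulVec, Matrix.smul_mulVec, ← Matrix.mulVec_mulVec, hl, Matrix.mulVec_zero, smul_zero,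
        add_zero] at h'
      exact h'
    simp only [← Matrix.mulVec_mulVec, h4, hl, Matrix.mulVec_zero]

/-- [our bookkeeping] **B5 (1.44) FOR THE TREE'S `R`**: `RT n M = 1 − G·Q′*·C·Q′·G` whenever `G` is a Hermitian two-sided inverse of `Δ + bQ′*Q′` and `C` a
Hermitian left inverse of `Q′G²Q′*` — both sides are Hermitian idempotents (`RT_mul_RT`, `RT_conjTranspose`; §4) with the same fixed space `ΔN(Q′)`
(`RT_mulVec_eq_self_iff`; `proj144_mulVec_eq_zero_iff`). -/
theorem RT_eq_one_sub_proj144 (hG : (LapS (fine n M) (n : ℂ) + (b : ℂ) • (QsAdj n M * QsOp n M)) * G = 1)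
    (hG' : G * (LapS (fine n M) (n : ℂ) + (b : ℂ) • (QsAdj n M * QsOp n M)) = 1) (hGh : Gᴴ = G)
    (hC : C * (QsOp n M * G * G * QsAdj n M) = 1) (hCh : Cᴴ = C) :
    RT n M = 1 - G * QsAdj n M * C * QsOp n M * G := by
  have hP2 := proj144_mul_proj144 n M hC
  have hPh := proj144_conjTranspose n M hGh hCh
  refine eq_of_idem_herm_fix (RT_mul_RT n M) ?_ (RT_conjTranspose n M) ?_ fun v => ?_
  · rw [Matrix.sub_mul, Matrix.one_mul, Matrix.mul_sub, Matrix.mul_one, hP2, sub_self, sub_zero]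
  · rw [Matrix.conjTranspose_sub, Matrix.conjTranspose_one, hPh]
  · rw [RT_mulVec_eq_self_iff, ← proj144_mulVec_eq_zero_iff n M b hG hG' hC, Matrix.sub_mulVec, Matrix.one_mulVec, sub_eq_self]

end P144

/-! ## §5 The concrete instance: `G′ = (Δ + bQ′*Q′)⁻¹`, `C = (Q′G′²Q′*)⁻¹` -/

section Concrete

variable {b : ℝ} (hb : 0 < b)
include hb

/-- [folklore] `(Δ + bQ′*Q′)·G′ = 1` for `G′ = (Δ + bQ′*Q′)⁻¹`, `b > 0`. -/
theorem DeltaP_mul_inv :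
    (LapS (fine n M) (n : ℂ) + (b : ℂ) • (QsAdj n M * QsOp n M)) * (LapS (fine n M) (n : ℂ) + (b : ℂ) • (QsAdj n M * QsOp n M))⁻¹ = 1 :=
  Matrix.mul_nonsing_inv _ ((Matrix.isUnit_iff_isUnit_det _).mp (isUnit_DeltaP n M hb))

/-- [folklore] `G′·(Δ + bQ′*Q′) = 1`. -/
theorem inv_mul_DeltaP :
    (LapS (fine n M) (n : ℂ) + (b : ℂ) • (QsAdj n M * QsOp n M))⁻¹ * (LapS (fine n M) (n : ℂ) + (b : ℂ) • (QsAdj n M * QsOp n M)) = 1 :=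
  Matrix.nonsing_inv_mul _ ((Matrix.isUnit_iff_isUnit_det _).mp (isUnit_DeltaP n M hb))

omit hb in
/-- [folklore] `G′ᴴ = G′`. -/
theorem DeltaP_inv_conjTranspose :
    ((LapS (fine n M) (n : ℂ) + (b : ℂ) • (QsAdj n M * QsOp n M))⁻¹)ᴴ = (LapS (fine n M) (n : ℂ) + (b : ℂ) • (QsAdj n M * QsOp n M))⁻¹ := by
  rw [Matrix.conjTranspose_nonsing_inv, DeltaP_conjTranspose]

/-- [folklore] **`Q′G′²Q′*` is invertible** (p. 25 «We have to verify it only for (Q′_kG′_k²Q′_k*)⁻¹»). -/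
theorem isUnit_QGGQ :
    IsUnit (QsOp n M * (LapS (fine n M) (n : ℂ) + (b : ℂ) • (QsAdj n M * QsOp n M))⁻¹
      * (LapS (fine n M) (n : ℂ) + (b : ℂ) • (QsAdj n M * QsOp n M))⁻¹ * QsAdj n M) := by
  refine Matrix.mulVec_injective_iff_isUnit.mp fun v w h => ?_
  rw [← sub_eq_zero]
  refine QGGQ_mulVec_eq_zero n M b (DeltaP_mul_inv n M hb) (DeltaP_inv_conjTranspose n M) ?_
  rw [Matrix.mulVec_sub, h, sub_self]

/-- [folklore] `(Q′G′²Q′*)⁻¹·(Q′G′²Q′*) = 1`. -/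
theorem QGGQ_inv_mul :
    (QsOp n M * (LapS (fine n M) (n : ℂ) + (b : ℂ) • (QsAdj n M * QsOp n M))⁻¹
        * (LapS (fine n M) (n : ℂ) + (b : ℂ) • (QsAdj n M * QsOp n M))⁻¹ * QsAdj n M)⁻¹
      * (QsOp n M * (LapS (fine n M) (n : ℂ) + (b : ℂ) • (QsAdj n M * QsOp n M))⁻¹
        * (LapS (fine n M) (n : ℂ) + (b : ℂ) • (QsAdj n M * QsOp n M))⁻¹ * QsAdj n M) = 1 :=
  Matrix.nonsing_inv_mul _ ((Matrix.isUnit_iff_isUnit_det _).mp (isUnit_QGGQ n M hb))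

omit hb in
/-- [folklore] `((Q′G′²Q′*)⁻¹)ᴴ = (Q′G′²Q′*)⁻¹` (`Q′G′²Q′* = n^{−d}·(G′Q′*)ᴴ(G′Q′*)` is Hermitian). -/
theorem QGGQ_inv_conjTranspose :
    ((QsOp n M * (LapS (fine n M) (n : ℂ) + (b : ℂ) • (QsAdj n M * QsOp n M))⁻¹
        * (LapS (fine n M) (n : ℂ) + (b : ℂ) • (QsAdj n M * QsOp n M))⁻¹ * QsAdj n M)⁻¹)ᴴ
      = (QsOp n M * (LapS (fine n M) (n : ℂ) + (b : ℂ) • (QsAdj n M * QsOp n M))⁻¹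
        * (LapS (fine n M) (n : ℂ) + (b : ℂ) • (QsAdj n M * QsOp n M))⁻¹ * QsAdj n M)⁻¹ := by
  have hs : star (((n : ℂ) ^ d)⁻¹) = ((n : ℂ) ^ d)⁻¹ := by rw [star_inv₀, star_pow, Complex.star_def, Complex.conj_natCast]
  rw [Matrix.conjTranspose_nonsing_inv, QGGQ_eq_smul_gram n M (DeltaP_inv_conjTranspose n M), Matrix.conjTranspose_smul, hs,
    Matrix.conjTranspose_mul, Matrix.conjTranspose_conjTranspose]

/-- [our bookkeeping] **(1.44) FOR THE TREE'S `R`, CONCRETELY**: for every `b > 0`,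
`RT n M = 1 − G′·Q′*·(Q′·G′·G′·Q′*)⁻¹·Q′·G′` with `G′ = (Δ + bQ′*Q′)⁻¹` — B5 p. 25 (1.44), p. 26 «independent of a … e.g. a = 1». -/
theorem RT_eq_one_sub_proj144_inv :
    RT n M = 1 - (LapS (fine n M) (n : ℂ) + (b : ℂ) • (QsAdj n M * QsOp n M))⁻¹ * QsAdj n M
      * (QsOp n M * (LapS (fine n M) (n : ℂ) + (b : ℂ) • (QsAdj n M * QsOp n M))⁻¹
          * (LapS (fine n M) (n : ℂ) + (b : ℂ) • (QsAdj n M * QsOp n M))⁻¹ * QsAdj n M)⁻¹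
      * QsOp n M * (LapS (fine n M) (n : ℂ) + (b : ℂ) • (QsAdj n M * QsOp n M))⁻¹ :=
  RT_eq_one_sub_proj144 n M b (DeltaP_mul_inv n M hb) (inv_mul_DeltaP n M hb) (DeltaP_inv_conjTranspose n M) (QGGQ_inv_mul n M hb)
    (QGGQ_inv_conjTranspose n M)

end Concrete

end Summit.QuantumFields.BalabanUV.Beta.FP.ScalarPropagatorProjection

end
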